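import Summits.HubbardSuperconductivity.HubbardSuperconductivity.Theorems.AnisotropyChordStiffnessZeroMode
import Summits.HubbardSuperconductivity.HubbardSuperconductivity.Theorems.AnisotropyChordInsertionEntropyOneStateSkeleton

/-!
# Route `AnisotropyChord` / H0 rotor rung: the ONE-STATE STIFFNESS SKELETON — «(S_Υ)^N + (K′)^N + H1⁗ ⇒ BEC» with every
# hypothesis on ONE sector sequence (theory seat `hubbard-h0-rotor-theory-1`, cycle 9, memo ROTOR-THEORY-9 §133,
# work-order W14: THEOREM TWIST-IR with `M ↦ M + 1`)

The tree's TWIST-IR chain (`infraredStructureBound_of_fsum_deficit`, `filteredCurrentDeficit_of_helicity`,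
`kLipschitzDeficit_of_farFieldKernelDecay`, `farFieldKernelDecay_holds`, `latticeFSumRule_holds`,
`continuityEquation_holds`) is written for the REFERENCE sector `M L − 1` of the two-state entropy route.  Applied to
the shifted sequence `L ↦ M L + 1` it speaks about the sector `M L` itself, which is what the one-state skeleton
`eventualCondensate_of_teleGaussianComparison` consumes:

* `UniformHelicityTensorN Δ M` ((S_Υ)^N) and `BoundedDensityResponseN Δ M` ((K′)^N): the single-sector typings;
  `uniformHelicityTensor_succ_of_N` transports (S_Υ)^N to the tree's `UniformHelicityTensor Δ (M + 1)`;
* `infraredStructureBoundN_of_succ` : `InfraredStructureBound Δ (M + 1) → InfraredStructureBoundN Δ M`;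
* **`infraredStructureBoundN_of_uniformHelicityTensorN`** : (S_Υ)^N ⇒ (IR_α)^N on the density window (TWIST-IR, no stub);
* **`structureFactorUpperN_of_boundedDensityResponseN`** : (K′)^N ⇒ (S_max)^N (f-sum rule + Cauchy–Schwarz, the
  single-sector rerun of `structureFactorUpper_of_susceptibility`, support clause by LEMMA ZM);
* **`eventualCondensate_of_oneState_stiffness`** : `ρ ∈ (0,1) → ρ_L → ρ → (S_Υ)^N → (K′)^N → H1⁗ → EventualCondensate` —
  no second sector, no `PerronSectorExists`, no sector non-emptiness hypothesis.
-/

set_option linter.dupNamespace false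

noncomputable section

open Matrix Complex Finset Filter Topology
open scoped ComplexConjugate
open Literature.MathematicalPhysics.QuantumLattice hiding torusPhase torusNorm
open Literature.Probability.LatticeModels
open Summit.HubbardSuperconductivity.HubbardSuperconductivity.Theorems.AnisotropyChord.InsertionEntropy

namespace Summit.HubbardSuperconductivity.HubbardSuperconductivity.Theorems.AnisotropyChord.Stiffness

/-- **HYPOTHESIS (S_Υ)^N — `UniformHelicityTensorN`**: the uniform helicity tensor `Υ ≥ Υ₀·1` for the Perron amplitude
of the sector `M_L` ITSELF (the tree's `UniformHelicityTensor Δ M` is the same statement for the reference sector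
`M_L − 1`). [conjecture: theory seat hubbard-h0-rotor-theory-1, cycle 9, 2026-08-28 — hypothesis (S_Υ) of H0, N-sector form (memo ROTOR-THEORY-9 §133)] -/
def UniformHelicityTensorN (Δ : ℝ) (M : ℕ → ℝ) : Prop :=
  ∃ Υ₀ > (0 : ℝ), ∀ᶠ L : ℕ in atTop, ∀ [NeZero L],
    ∀ a : TensorIndex (TorusSite 2 L) 2 → ℝ, IsPerronSectorGroundAmplitude L Δ (M L) a →
      ∀ ε : Fin 2 → ℂ,
        2 * ∑ i, ‖∑ j, ε j * currentAmp L Δ a 0 j i‖ ^ 2 / excitation L Δ (M L) i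
          ≤ ∑ j, ‖ε j‖ ^ 2 * (kineticExpect L a j - Υ₀ * (L : ℝ) ^ 2)

/-- **HYPOTHESIS (K′)^N — `BoundedDensityResponseN`**: bounded static density response
`Σᵢ |⟨vᵢ, ρ_k ψ⟩|²/ωᵢ ≤ κ L²` (`k ≠ 0`) for the Perron amplitude of the sector `M_L` itself (the honest clause of (K);
the support clause is the tree's `densityAmp_eq_zero_of_excitation_nonpos`). [conjecture: theory seat hubbard-h0-rotor-theory-1, cycle 9, 2026-08-28 — hypothesis (K) of H0, N-sector form (memo ROTOR-THEORY-9 §133)] -/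
def BoundedDensityResponseN (Δ : ℝ) (M : ℕ → ℝ) : Prop :=
  ∃ κ : ℝ, ∀ᶠ L : ℕ in atTop, ∀ [NeZero L],
    ∀ a : TensorIndex (TorusSite 2 L) 2 → ℝ, IsPerronSectorGroundAmplitude L Δ (M L) a →
      ∀ k : TorusSite 2 L, k ≠ 0 →
        ∑ i, ‖densityAmp L Δ a k i‖ ^ 2 / excitation L Δ (M L) i ≤ κ * (L : ℝ) ^ 2

/-- (S_Υ)^N for `M` is the tree's (S_Υ) for the shifted sequence `M + 1`. [folklore] -/
theorem uniformHelicityTensor_succ_of_N (Δ : ℝ) (M : ℕ → ℝ) (h : UniformHelicityTensorN Δ M) :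
    UniformHelicityTensor Δ (fun L => M L + 1) := by
  obtain ⟨Υ₀, hΥ₀, hev⟩ := h
  refine ⟨Υ₀, hΥ₀, ?_⟩
  filter_upwards [hev] with L hL
  intro _ a ha ε
  simp only [add_sub_cancel_right] at ha ⊢
  exact hL a ha ε

/-- (IR_α) for the shifted sequence `M + 1` is (IR_α)^N for `M`. [folklore] -/
theorem infraredStructureBoundN_of_succ (Δ : ℝ) (M : ℕ → ℝ)
    (h : InfraredStructureBound Δ (fun L => M L + 1)) : InfraredStructureBoundN Δ M := by
  obtain ⟨c, hc, α, hα, hev⟩ := h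
  refine ⟨c, hc, α, hα, ?_⟩
  filter_upwards [hev] with L hL
  intro _ aN haN k hk
  simp only [add_sub_cancel_right] at hL
  exact hL aN haN k hk

/-- The density window along `ρ_L = 1/2 + M_L/L² → ρ ∈ (0,1)`: eventually `0 < P_L = L²/2 + M_L ≤ L²`, and
`ρ/2 · L² ≤ P_L`. [folklore] -/
theorem density_window (M : ℕ → ℝ) (ρ : ℝ) (hρ : ρ ∈ Set.Ioo (0 : ℝ) 1)
    (hlim : Tendsto (fun L : ℕ => 1 / 2 + M L / (L : ℝ) ^ 2) atTop (nhds ρ)) :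
    ∀ᶠ L : ℕ in atTop, ∀ [NeZero L],
      0 < (L : ℝ) ^ 2 / 2 + M L ∧ (L : ℝ) ^ 2 / 2 + M L ≤ (L : ℝ) ^ 2 ∧
        ρ / 2 * (L : ℝ) ^ 2 ≤ (L : ℝ) ^ 2 / 2 + M L := by
  have hρ0 : 0 < ρ := hρ.1
  have hρ1 : ρ < 1 := hρ.2
  have hlo : ∀ᶠ L : ℕ in atTop, ρ / 2 ≤ 1 / 2 + M L / (L : ℝ) ^ 2 :=
    hlim.eventually (eventually_ge_nhds (by linarith))
  have hhi : ∀ᶠ L : ℕ in atTop, 1 / 2 + M L / (L : ℝ) ^ 2 ≤ (1 + ρ) / 2 :=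
    hlim.eventually (eventually_le_nhds (by linarith))
  filter_upwards [hlo, hhi] with L hlo hhi
  intro _
  have hL' : (L : ℝ) ≠ 0 := by exact_mod_cast (NeZero.ne L)
  have hL : (0 : ℝ) < (L : ℝ) ^ 2 := by positivity
  have hPM : (L : ℝ) ^ 2 / 2 + M L = (L : ℝ) ^ 2 * (1 / 2 + M L / (L : ℝ) ^ 2) := by
    field_simp
  rw [hPM]
  refine ⟨?_, ?_, ?_⟩
  · have : 0 < 1 / 2 + M L / (L : ℝ) ^ 2 := lt_of_lt_of_le (by linarith) hlo
    positivity
  · have : 1 / 2 + M L / (L : ℝ) ^ 2 ≤ 1 := hhi.trans (by linarith)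
    nlinarith
  · nlinarith

/-- **(S_Υ)^N ⇒ (IR_α)^N (PROVED; THEOREM TWIST-IR for the sector itself).**  Along `ρ_L → ρ ∈ (0,1)`, the uniform
helicity tensor of the sector-`M_L` Perron amplitudes gives `S(k) ≥ c|k|_T^α`, `α < 2`, for the same amplitudes — the
tree's TWIST-IR chain run on `L ↦ M_L + 1` (f-sum rule, continuity, Lieb–Robinson far field K2, double commutator K1′,
all tree theorems). [folklore] -/
theorem infraredStructureBoundN_of_uniformHelicityTensorN (Δ : ℝ) (M : ℕ → ℝ) (ρ : ℝ)
    (hρ : ρ ∈ Set.Ioo (0 : ℝ) 1)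
    (hlim : Tendsto (fun L : ℕ => 1 / 2 + M L / (L : ℝ) ^ 2) atTop (nhds ρ))
    (hU : UniformHelicityTensorN Δ M) : InfraredStructureBoundN Δ M := by
  refine infraredStructureBoundN_of_succ Δ M
    (infraredStructureBound_of_fsum_deficit Δ (fun L => M L + 1) (latticeFSumRule_holds Δ)
      (filteredCurrentDeficit_of_helicity Δ (fun L => M L + 1) continuityEquation_holds
        (kLipschitzDeficit_of_farFieldKernelDecay Δ (fun L => M L + 1)
          (farFieldKernelDecay_holds Δ (fun L => M L + 1)))
        (uniformHelicityTensor_succ_of_N Δ M hU)) ?_)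
  filter_upwards [density_window M ρ hρ hlim] with L hL
  intro _
  obtain ⟨h0, h1, -⟩ := hL
  simp only [add_sub_cancel_right]
  exact ⟨h0, h1⟩

/-- **(K′)^N ⇒ (S_max)^N (PROVED; single-sector rerun of `structureFactorUpper_of_susceptibility`).**
`(P·S(k))² = (Σᵢ|cᵢ|²)² ≤ m₁(k)·m₋₁(k) ≤ 2L²·κ⁺L²` with `m₁ ≤ 2L²` (lattice f-sum rule, `⟨−T_j⟩ ≤ L²/2`), `m₋₁ ≤ κL²`
((K′)^N; the terms at `ωᵢ ≤ 0` vanish by LEMMA ZM / sector vanishing) and `P ≥ (ρ/2)L²`: `S(k) ≤ 2√(2κ⁺)/ρ`. [folklore] -/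
theorem structureFactorUpperN_of_boundedDensityResponseN (Δ : ℝ) (M : ℕ → ℝ) (ρ : ℝ)
    (hρ : ρ ∈ Set.Ioo (0 : ℝ) 1)
    (hlim : Tendsto (fun L : ℕ => 1 / 2 + M L / (L : ℝ) ^ 2) atTop (nhds ρ))
    (hK : BoundedDensityResponseN Δ M) : StructureFactorUpperN Δ M := by
  obtain ⟨κ, hκ⟩ := hK
  have hρ0 : 0 < ρ := hρ.1
  have hκ' : 0 ≤ 2 * max κ 0 := by positivity
  refine ⟨2 * Real.sqrt (2 * max κ 0) / ρ, ?_⟩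
  filter_upwards [hκ, density_window M ρ hρ hlim, eventually_ge_atTop 3] with L hKL hW h3
  intro _ a ha k hk
  have hL0 : (0 : ℝ) < (L : ℝ) := by exact_mod_cast Nat.pos_of_ne_zero (NeZero.ne L)
  have hL2 : (0 : ℝ) < (L : ℝ) ^ 2 := by positivity
  obtain ⟨hP0, -, hPlo⟩ := hW
  have hzero : ∀ i, excitation L Δ (M L) i ≤ 0 → densityAmp L Δ a k i = 0 :=
    fun i hi => densityAmp_eq_zero_of_excitation_nonpos L Δ (M L) a ha hk i hi
  have hm := hKL a ha k hk
  -- Parseval: X = P·S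
  have hX : ∑ i, ‖densityAmp L Δ a k i‖ ^ 2 = ((L : ℝ) ^ 2 / 2 + M L) * structureFactor L a ((L : ℝ) ^ 2 / 2 + M L) k := by
    unfold densityAmp
    rw [sum_norm_sq_eigen_dotProduct, normSq_densityMode_mulVec L a _ hP0.ne' k]
  -- m₁ = f-sum ≤ 2L²
  have hFL := latticeFSumRule_holds Δ L h3 (M L) a ha k
  have hdiv : ∀ i, currentSpecWeight L Δ a k i / excitation L Δ (M L) i
      = excitation L Δ (M L) i * ‖densityAmp L Δ a k i‖ ^ 2 := by
    intro i
    rw [currentSpecWeight_eq_sq L Δ (M L) a ha k i]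
    rcases eq_or_ne (excitation L Δ (M L) i) 0 with h0 | h0
    · simp [h0]
    · rw [div_eq_iff h0]
      ring
  have hm1 : ∑ i, excitation L Δ (M L) i * ‖densityAmp L Δ a k i‖ ^ 2 ≤ 2 * (L : ℝ) ^ 2 := by
    rw [show (∑ i, excitation L Δ (M L) i * ‖densityAmp L Δ a k i‖ ^ 2)
        = ∑ j : Fin 2, fsumWeight L k j * kineticExpect L a j from by
          rw [← hFL]; exact Finset.sum_congr rfl fun i _ => (hdiv i).symm]
    calc ∑ j : Fin 2, fsumWeight L k j * kineticExpect L a j ≤ ∑ j : Fin 2, (L : ℝ) ^ 2 := by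
          refine Finset.sum_le_sum fun j _ => ?_
          have hfw0 := fsumWeight_nonneg L k j
          have hfw2 := fsumWeight_le_two L k j
          have hke := kineticExpect_le L ha j
          nlinarith [mul_le_mul_of_nonneg_left hke hfw0]
      _ = 2 * (L : ℝ) ^ 2 := by
          rw [Finset.sum_const, Finset.card_univ, Fintype.card_fin, nsmul_eq_mul, Nat.cast_ofNat]
  -- m₋₁ ≤ κ⁺ L²
  have hm_1 : ∑ i, ‖densityAmp L Δ a k i‖ ^ 2 / excitation L Δ (M L) i ≤ max κ 0 * (L : ℝ) ^ 2 :=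
    hm.trans (mul_le_mul_of_nonneg_right (le_max_left κ 0) hL2.le)
  -- Cauchy–Schwarz
  obtain ⟨hcs, hm1nn, hm_1nn⟩ := cs_spectral (fun i => ‖densityAmp L Δ a k i‖) (fun i => excitation L Δ (M L) i)
    (fun i hi => by rw [hzero i hi, norm_zero])
  have hX2 : (∑ i, ‖densityAmp L Δ a k i‖ ^ 2) ^ 2 ≤ (2 * (L : ℝ) ^ 2) * (max κ 0 * (L : ℝ) ^ 2) :=
    hcs.trans (mul_le_mul hm1 hm_1 hm_1nn (by positivity))
  have hB2 : (Real.sqrt (2 * max κ 0) * (L : ℝ) ^ 2) ^ 2 = (2 * (L : ℝ) ^ 2) * (max κ 0 * (L : ℝ) ^ 2) := by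
    rw [mul_pow, Real.sq_sqrt hκ']
    ring
  have hXB : ∑ i, ‖densityAmp L Δ a k i‖ ^ 2 ≤ Real.sqrt (2 * max κ 0) * (L : ℝ) ^ 2 := by
    have h := Real.sqrt_le_sqrt (hX2.trans hB2.symm.le)
    rwa [Real.sqrt_sq (Finset.sum_nonneg fun i _ => sq_nonneg _), Real.sqrt_sq (by positivity)] at h
  -- conclusion
  have h5 : Real.sqrt (2 * max κ 0) * (L : ℝ) ^ 2
      ≤ ((L : ℝ) ^ 2 / 2 + M L) * (2 * Real.sqrt (2 * max κ 0) / ρ) := by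
    rw [mul_div_assoc', le_div_iff₀ hρ0]
    nlinarith [mul_le_mul_of_nonneg_left hPlo (Real.sqrt_nonneg (2 * max κ 0))]
  have h6 : ((L : ℝ) ^ 2 / 2 + M L) * structureFactor L a ((L : ℝ) ^ 2 / 2 + M L) k
      ≤ ((L : ℝ) ^ 2 / 2 + M L) * (2 * Real.sqrt (2 * max κ 0) / ρ) := by
    rw [← hX]
    exact hXB.trans h5
  exact le_of_mul_le_mul_left h6 hP0

/-- **THE ONE-STATE H0 ROTOR RUNG, END TO END (PROVED modulo its three physical hypotheses, all on ONE sector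
sequence):** along `ρ_L = 1/2 + M_L/L² → ρ ∈ (0,1)`, «uniform helicity tensor (S_Υ)^N + bounded density response (K′)^N
+ Gaussian domination of ONE conditional pair (H1⁗) ⇒ Bose–Einstein condensation» for the hard-core Bose gas on
`(ℤ/L)²`.  No reference sector `M_L − 1`, no `PerronSectorExists`, no sector non-emptiness hypothesis; every analytic
input (TWIST-IR, f-sum rule, LEMMA ZM, one-state E-floor, lattice sum) is a tree theorem.  Theory seat memo
ROTOR-THEORY-9 §133 (one-state skeleton) composed with THEOREM TWIST-IR at `M ↦ M + 1`. [folklore] -/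
theorem eventualCondensate_of_oneState_stiffness (Δ : ℝ) (M : ℕ → ℝ) (ρ : ℝ)
    (hρ : ρ ∈ Set.Ioo (0 : ℝ) 1)
    (hlim : Tendsto (fun L : ℕ => 1 / 2 + M L / (L : ℝ) ^ 2) atTop (nhds ρ))
    (hU : UniformHelicityTensorN Δ M) (hK : BoundedDensityResponseN Δ M)
    (hG : TeleGaussianComparison Δ M) : EventualCondensate Δ M :=
  eventualCondensate_of_teleGaussianComparison Δ M ρ hρ hlim hG
    (infraredStructureBoundN_of_uniformHelicityTensorN Δ M ρ hρ hlim hU)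
    (structureFactorUpperN_of_boundedDensityResponseN Δ M ρ hρ hlim hK)

end Summit.HubbardSuperconductivity.HubbardSuperconductivity.Theorems.AnisotropyChord.Stiffness
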